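import Summits.ResolutionOfSingularities.ResolutionOfSingularities.Theses.HilbertSamuelElimination
import Literature.AlgebraicGeometry.Resolution.HilbertSamuelLocal

/-!
# `SigmaMaxModifications` — negative lemmas II: level dependence of `X_max`, level transfer,
# and a printed cycle of permissible blow-ups

Support (negative) lemmas for crux `stmt-ResolutionOfSingularities-18506`
(`Summit.ResolutionOfSingularities.ResolutionOfSingularities.Theses.HilbertSamuelElimination.SigmaMaxModifications`,
CJS LNM 2270 Def. 6.15 in modification form, quantified over ALL levels `N ≥ dim X`), filed by
the standing disprover (cdisprove cycle 1; work file `Cruxes/SigmaMaxModifications/Disproof.lean`;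
companion of `LoadBearing.lean`). No definition; nothing concludes the route decl positively. The
crux's inline `H` is the tree's `Scheme.hsFun` by `rfl` (`LoadBearing.sigmaMaxModifications_iff_hsFun`).

* `hsFun_succ` (`H^{N+1} = (H^N)^{(1)}` once `ψ ≤ N`), `hsMaxLocus_succ_subset`
  (`X_max(N+1) ⊆ X_max(N)`): partial summation is monotone and injective but NOT an order
  embedding (CJS Rem. 2.29 (b)), and the inclusion is STRICT for the reduced curve
  `Spec 𝔽_p[t⁷,t⁹,t¹⁹] ⊔ Spec 𝔽_p[t⁷,t⁸,t¹⁸]` (cusp values `(1,3,5,5,6,7,7,…)`, `(1,3,5,6,6,6,7,…)`: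
  incomparable, partial sums comparable) — so the crux's `∀ N ≥ dim X` is a genuine quantifier:
  (ME1) strengthens with `N`, monotonicity and (ME2) weaken (`hsFun_succ_le_of_le`).
* Transfer: `hsStratum_succ_psum`, `psum_not_mem_hsValues_succ`, `maximal_of_maximal_psum_succ`
  — ν-wise statements (CJS Def. 6.14) move UP in level; the glued form (Def. 6.15; e.g. the tree
  fact `CossartJannsenSaito2020_sigmaMaxElimination`, pinned at `N = 2`) does not literally give
  the `dim ≤ 2` case of the crux at levels `N ≠ 2`.
* `spivakovsky_hauser_cycle`: "every sequence of permissible blow-ups inside `X_max` terminates"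
  is FALSE in print in all characteristics (Spivakovsky 1989 / Hauser 1998 Ex. 2,
  `x³ + yz²w⁴ + yz⁴w²`: a 2-cycle of permissible axis blow-ups; chart identities) — a negative
  result on the PROCESS; the crux (existence of SOME Σ^max-modification) is untouched.

## Sources
* V. Cossart, U. Jannsen, S. Saito, LNM 2270 (2020): Def. 2.28, Rem. 2.29, Def. 6.14, Def. 6.15.
* H. Hauser, *Seventeen Obstacles for Resolution of Singularities*, in: Singularities
  (Oberwolfach 1996), Progr. Math. 162, Birkhäuser (1998), 289–313: Example 2. [Hauser1998]
* M. Spivakovsky, *A counterexample to the theorem of Beppo Levi in three dimensions*,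
  Invent. Math. 96 (1989), 181–183. [Spivakovsky1989]
* The Stacks Project, Tag 02IZ.
-/

noncomputable section

-- single-problem summit: the doubled namespace component `ResolutionOfSingularities` is forced
set_option linter.dupNamespace false

open CategoryTheory AlgebraicGeometry TopologicalSpace Topology
open Literature.RingTheory.HilbertSamuel Literature.AlgebraicGeometry.Resolution

namespace Summit.ResolutionOfSingularities.ResolutionOfSingularities.Theorems.SigmaMaxModifications.Negative

/-- `dim 𝒪_{X,x} ≤ dim X` (`dim 𝒪_{X,x}` is the coheight of `x` in the specialisation order).
[cite: StacksProject, Tag 02IZ] -/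
theorem ringKrullDim_stalk_le_topologicalKrullDim' (X : Scheme.{0}) (x : X) :
    ringKrullDim (X.presheaf.stalk x) ≤ topologicalKrullDim X := by
  rw [AlgebraicGeometry.ringKrullDim_stalk_eq_coheight, topologicalKrullDim,
    Order.krullDim_eq_of_orderIso (irreducibleSetEquivPoints (α := X))]
  exact Order.coheight_le_krullDim x

/-! ## Level dependence: `X_max(N+1) ⊆ X_max(N)` -/

/-- `ψ_X(x) ≤ N` once `dim X ≤ N` (`ψ ≤ dim 𝒪_{X,x} ≤ dim X`). [cite: CossartJannsenSaito2020, Def. 2.28] -/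
theorem hsPsi_le_of_dim_le {X : Scheme.{0}} [IsLocallyNoetherian X] {N : ℕ}
    (hdim : topologicalKrullDim X ≤ (N : WithBot ℕ∞)) (x : X) : Scheme.hsPsi X x ≤ N := by
  have h1 : (Scheme.hsPsi X x : WithBot ℕ∞) ≤ ringKrullDim (X.presheaf.stalk x) :=
    minimalPrimesCodim_le_ringKrullDim (X.presheaf.stalk x)
  have h2 := (h1.trans (ringKrullDim_stalk_le_topologicalKrullDim' X x)).trans hdim
  exact_mod_cast h2

/-- **`H^{N+1}_X(x) = (H^N_X(x))^{(1)}`** as soon as `ψ_X(x) ≤ N`. [cite: CossartJannsenSaito2020, Rem. 2.29 (b)] -/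
theorem hsFun_succ {X : Scheme.{0}} {N : ℕ} (x : X) (hψ : Scheme.hsPsi X x ≤ N) :
    Scheme.hsFun X (N + 1) x = psum (Scheme.hsFun X N x) := by
  rw [Scheme.hsFun_def, Scheme.hsFun_def, Nat.succ_sub hψ, hilbertSamuelFun_succ]

/-- **`X_max(N+1) ⊆ X_max(N)`** (`dim X ≤ N`): partial summation is monotone and injective, so
maximal at level `N + 1` implies maximal at level `N`. It is NOT an order embedding (CJS Rem.
2.29 (b)) and the inclusion is STRICT for the reduced curve
`Spec 𝔽_p[t⁷,t⁹,t¹⁹] ⊔ Spec 𝔽_p[t⁷,t⁸,t¹⁸]` (cusp values `(1,3,5,5,6,7,7,…)`, `(1,3,5,6,6,6,7,…)`: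
incomparable, partial sums comparable), so the crux's `∀ N ≥ dim X` is a genuine quantifier:
(ME1) strengthens with `N`, monotonicity and (ME2) weaken. [cite: CossartJannsenSaito2020, Rem. 2.29] -/
theorem hsMaxLocus_succ_subset {X : Scheme.{0}} [IsLocallyNoetherian X] {N : ℕ}
    (hdim : topologicalKrullDim X ≤ (N : WithBot ℕ∞)) :
    Scheme.hsMaxLocus X (N + 1) ⊆ Scheme.hsMaxLocus X N := by
  intro x hx
  rw [Scheme.mem_hsMaxLocus_iff] at hx ⊢
  refine ⟨⟨x, rfl⟩, ?_⟩
  rintro _ ⟨y, rfl⟩ hxy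
  have h1 : Scheme.hsFun X (N + 1) x ≤ Scheme.hsFun X (N + 1) y := by
    rw [hsFun_succ x (hsPsi_le_of_dim_le hdim x), hsFun_succ y (hsPsi_le_of_dim_le hdim y)]
    exact psum_mono hxy
  have h2 : Scheme.hsFun X (N + 1) y ≤ Scheme.hsFun X (N + 1) x := hx.2 ⟨y, rfl⟩ h1
  have heq : Scheme.hsFun X (N + 1) y = Scheme.hsFun X (N + 1) x := le_antisymm h2 h1
  rw [hsFun_succ x (hsPsi_le_of_dim_le hdim x), hsFun_succ y (hsPsi_le_of_dim_le hdim y)] at heq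
  rw [psum_injective heq]

/-- Monotonicity passes UP one level (not down): `H^N_{X'}(x') ≤ H^N_X(x)` implies the same at
level `N + 1`. [folklore] -/
theorem hsFun_succ_le_of_le {X X' : Scheme.{0}} {N : ℕ} {x : X} {x' : X'}
    (hψ : Scheme.hsPsi X x ≤ N) (hψ' : Scheme.hsPsi X' x' ≤ N)
    (h : Scheme.hsFun X' N x' ≤ Scheme.hsFun X N x) :
    Scheme.hsFun X' (N + 1) x' ≤ Scheme.hsFun X (N + 1) x := by
  rw [hsFun_succ x hψ, hsFun_succ x' hψ']
  exact psum_mono h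

/-- **Strata transfer up one level**: `X(ν)` at level `N` is `X(ν^{(1)})` at level `N + 1`
(`dim X ≤ N`). So "`π` is an isomorphism off `X(ν)`" is level-independent in this sense.
[cite: CossartJannsenSaito2020, Rem. 2.29 (b)] -/
theorem hsStratum_succ_psum {X : Scheme.{0}} [IsLocallyNoetherian X] {N : ℕ}
    (hdim : topologicalKrullDim X ≤ (N : WithBot ℕ∞)) (ν : ℕ → ℕ) :
    Scheme.hsStratum X (N + 1) (psum ν) = Scheme.hsStratum X N ν := by
  ext x
  simp only [Scheme.mem_hsStratum_iff]
  rw [hsFun_succ x (hsPsi_le_of_dim_le hdim x)]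
  exact psum_injective.eq_iff

/-- **Killing a value transfers up one level**: `ν ∉ Σ_{X'}(N)` implies `ν^{(1)} ∉ Σ_{X'}(N+1)`
(`dim X' ≤ N`). [cite: CossartJannsenSaito2020, Rem. 2.29 (b)] -/
theorem psum_not_mem_hsValues_succ {X : Scheme.{0}} [IsLocallyNoetherian X] {N : ℕ}
    (hdim : topologicalKrullDim X ≤ (N : WithBot ℕ∞)) {ν : ℕ → ℕ}
    (h : ν ∉ Scheme.hsValues X N) : psum ν ∉ Scheme.hsValues X (N + 1) := by
  rintro ⟨x, hx⟩
  rw [hsFun_succ x (hsPsi_le_of_dim_le hdim x)] at hx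
  exact h ⟨x, psum_injective hx⟩

/-- **Maximal values transfer DOWN one level**: if `ν^{(1)}` is a maximal value at level `N + 1`
then `ν` is a maximal value at level `N` (`dim X ≤ N`); the converse fails (§4 example). Hence
`Σ^max(N+1) = {ν^{(1)} : ν ∈ S}` for a SUBSET `S ⊆ Σ^max(N)`, and a level-`(N+1)`
Σ^max-modification is obtained by gluing level-`N` ν-modifications for `ν ∈ S` ONLY — which is
why the ν-wise form (CJS Def. 6.14, lead's `stub_nuEliminationsExist`) transfers across levels
while the glued form (Def. 6.15; the tree fact `CossartJannsenSaito2020_sigmaMaxElimination`,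
pinned at `N = 2`) does NOT: for `dim X ≤ 2` at levels `N ≠ 2` the crux is not literally an
instance of that fact (at `N = 1` the level-2 elimination can leave a level-1-maximal point
untouched, violating (ME2) — the curve `C₁ ⊔ C₂` of `hsMaxLocus_succ_subset`; at `N ≥ 3` its
centres over `X_max(2) ∖ X_max(N)` can violate (ME1)). [cite: CossartJannsenSaito2020, Rem. 2.29 (b), Def. 6.14] -/
theorem maximal_of_maximal_psum_succ {X : Scheme.{0}} [IsLocallyNoetherian X] {N : ℕ}
    (hdim : topologicalKrullDim X ≤ (N : WithBot ℕ∞)) {ν : ℕ → ℕ} (hν : ν ∈ Scheme.hsValues X N)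
    (hmax : Maximal (· ∈ Scheme.hsValues X (N + 1)) (psum ν)) :
    Maximal (· ∈ Scheme.hsValues X N) ν := by
  refine ⟨hν, ?_⟩
  rintro _ ⟨y, rfl⟩ hνy
  have h1 : psum ν ≤ Scheme.hsFun X (N + 1) y := by
    rw [hsFun_succ y (hsPsi_le_of_dim_le hdim y)]
    exact psum_mono hνy
  have h2 : Scheme.hsFun X (N + 1) y ≤ psum ν := hmax.2 ⟨y, rfl⟩ h1
  have heq : Scheme.hsFun X (N + 1) y = psum ν := le_antisymm h2 h1
  rw [hsFun_succ y (hsPsi_le_of_dim_le hdim y)] at heq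
  rw [psum_injective heq]

/-! ## A printed negative result on the elimination PROCESS (not on the crux) -/

/-- **"Every sequence of permissible blow-ups with centres inside `X_max` terminates" is FALSE
in print, in every characteristic** (Spivakovsky 1989; the variant printed as Hauser 1998,
Example 2): for the threefold `X = V(f) ⊂ 𝔸⁴`, `f = x³ + yz²w⁴ + yz⁴w²`, the Hilbert–Samuel
(= multiplicity-`3`) locus is the union of the `y`-, `z`-, `w`-axes; blowing up the `w`-axis
`V(x,y,z)` (permissible: order `3` all along it) gives in the `y`-chart `x ↦ xy, z ↦ zy` the
strict transform `f' = x³ + z²w⁴ + y²z⁴w²`; blowing up the `z`-axis `V(x,y,w)` of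
`X' = V(f')` (permissible) gives back `f` in the `y`-chart `x ↦ xy, w ↦ wy` — a CYCLE of length
two of permissible blow-ups inside `X_max` along which the maximal value survives, so no finite
piece of the sequence satisfies (ME2). A ν-elimination must therefore CHOOSE its centres (CJS
Rem. 6.29 blows up the singular point of `X_max` first and labels old/new components); the
crux itself — SOME Σ^max-modification — survives (characteristic `0`: Hironaka; characteristic
`3`, where `f = x³ + g` is purely inseparable: open, a test specimen). Recorded as the two chart
identities, the algebraic content of the cycle. [cite: Hauser1998, Example 2; Spivakovsky1989] -/
theorem spivakovsky_hauser_cycle {R : Type*} [CommRing R] (x y z w : R) :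
    ((x * y) ^ 3 + y * (z * y) ^ 2 * w ^ 4 + y * (z * y) ^ 4 * w ^ 2 =
        y ^ 3 * (x ^ 3 + z ^ 2 * w ^ 4 + y ^ 2 * z ^ 4 * w ^ 2)) ∧
      ((x * y) ^ 3 + z ^ 2 * (w * y) ^ 4 + y ^ 2 * z ^ 4 * (w * y) ^ 2 =
        y ^ 3 * (x ^ 3 + y * z ^ 2 * w ^ 4 + y * z ^ 4 * w ^ 2)) :=
  ⟨by ring, by ring⟩

end Summit.ResolutionOfSingularities.ResolutionOfSingularities.Theorems.SigmaMaxModifications.Negative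

end
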